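import Literature.AlgebraicGeometry.AbelianSchemes.AbelianSchemeOverBase
import Literature.AlgebraicGeometry.AbelianSchemes.AbelianSchemeOverField
import HarnessLib

/-!
# Abelian schemes over a base: isomorphisms of group schemes are base changes along `𝟙 S`, and the IDENTITY FIBRE
# `A ×_S S` of an abelian scheme over `S = Spec K` is `A` itself as a group scheme
# ([MumfordFogartyKirwan1994] Ch. 7 §2 Def. 7.3; [GortzWedhorn2020] (4.7))

Topic `AlgebraicGeometry/AbelianSchemes`; namespace `Literature.AlgebraicGeometry.AbelianSchemes.AbelianSchemeOver`.
Cell hodgecm-mathlib (D-0151), rung-0 ladder / M1PRIME-DAG W3 (triple transport, census B-p13 rows (c-i)/(c-iv)) over the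
★ D1 carrier `AbelianSchemeOverBase`.  THEOREMS + two non-Prop plumbing isos (no structure, no named fact, no instance,
no `sorry`); books 0.  HC_CM is proved only modulo the printed citations until rung 0 closes.

## What is proved
* §1 `isBaseChangeVia_id_of_isMonHom` — an ISOMORPHISM of `S`-group schemes `G : A′.X ⟶ A.X` exhibits `A′` as the base change of
  `A` along `𝟙 S` (`AbelianSchemeOver.IsBaseChangeVia`: cartesian square by `IsPullback.of_horiz_isIso`, unit and
  multiplication clauses = `IsMonHom.one_hom` / `mul_hom` read through Mathlib `Over.tensorHom_left`);
  `levelStructure_isBaseChangeVia_id_of_isMonHom` — with the level clause from `σ′ᵢ ≫ G = σᵢ` — i.e. [MFK94] Def. 7.3's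
  «isomorphism of triples» = pull-back along `𝟙 S`, the `X`-clause and the level clause.
* §2 the identity fibre: `overPullbackIdIso S : Over.pullback (𝟙 S) ≅ 𝟭` with components `pullback.fst _ (𝟙 S)` (explicit);
  `fibreIdToGrpIso A : (A.fibre (𝟙 _)).toAbelianVariety.toGrp ≅ A.toAffine.toAbelianVariety.toGrp` — the cartesian-monoidal
  natural isomorphism lifts to GROUP objects (`Functor.mapGrpNatIso`, `Functor.mapGrpIdIso`; the template of ★
  `AbelianScheme.fibreToGrpBaseChangeIso`), with underlying scheme map `pullback.fst` (`fibreIdToGrpIso_hom_left`);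
  `fibreIdIso` the same in `AbelianVariety K`.
* §3 from FIBRE data to SCHEME data over `Spec K`: `grpIsoOfFibreIso` turns an isomorphism of the identity fibres (as abelian
  varieties — what the tree's marking theorems ★ `SiegelAdelicMarking.exists_iso_forall_map_r_eq_self`, ★
  `isIso_of_exists_forall_adelicCongr` produce) into an isomorphism of the `Spec K`-group schemes;
  `isBaseChangeVia_id_of_fibreIso`; `section_comp_grpIso_eq` — if the fibre isomorphism carries the point `σ′(𝟙)` to
  `σ(𝟙)` (`restrictPt`), the induced isomorphism carries the SECTION `σ′` to `σ`;
  `levelStructure_isBaseChangeVia_id_of_fibreIso` — the level/X clause of Def. 7.3 along `𝟙 (Spec K)` from fibre data.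

## References
* [MumfordFogartyKirwan1994] D. Mumford, J. Fogarty, F. Kirwan, *Geometric Invariant Theory*, 3rd ed. (1994), Ch. 7 §2
  Definition 7.3 (p. 130) (pull-back of triples; isomorphism = pull-back along the identity).
* [GortzWedhorn2020] U. Görtz, T. Wedhorn, *Algebraic Geometry I*, 2nd ed. (2020), Section (4.7) (base change, transitivity,
  `X ×_S S = X`), Remark 16.54 (base change of group schemes).
-/

set_option autoImplicit false

universe u

open CategoryTheory CategoryTheory.Limits AlgebraicGeometry MonoidalCategory
open scoped MonObj

noncomputable section

namespace Literature.AlgebraicGeometry.AbelianSchemes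

namespace AbelianSchemeOver

open Literature.AlgebraicGeometry.Motives (SchemeOver AbelianVariety AlgPoints)



variable {S : Scheme.{u}}

/-- **(c-i) An isomorphism of `S`-group schemes is a base change along `𝟙 S`** (`AbelianSchemeOver.IsBaseChangeVia`):
the square `(G, 𝟙)` is cartesian because `G.left` is an isomorphism (`IsPullback.of_horiz_isIso`), and the unit /
multiplication clauses are `IsMonHom.one_hom` / `IsMonHom.mul_hom` read on underlying schemes
(`Over.tensorHom_left`). [cite: MumfordFogartyKirwan1994, Ch. 7 §2 Definition 7.3 (p. 130)] -/
theorem isBaseChangeVia_id_of_isMonHom (A' A : AbelianSchemeOver S) (G : A'.X ⟶ A.X) [IsIso G] [IsMonHom G] :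
    A'.IsBaseChangeVia A (𝟙 S) G.left := by
  haveI : IsIso G.left := (inferInstance : IsIso ((Over.forget S).map G))
  have w : G.left ≫ A.X.hom = A'.X.hom ≫ 𝟙 S := by rw [Category.comp_id, Over.w]
  refine ⟨w, IsPullback.of_horiz_isIso ⟨w⟩, ?_, ?_⟩
  · rw [Category.id_comp, ← Over.comp_left, IsMonHom.one_hom]
  · have h : (μ[A'.X] ≫ G).left = ((G ⊗ₘ G) ≫ μ[A.X]).left := by rw [IsMonHom.mul_hom]
    rw [Over.comp_left, Over.comp_left, Over.tensorHom_left] at h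
    exact h

/-- **(c-iv) … with the LEVEL clause**: if moreover `G` carries the level sections of `A'` to those of `A`
(`σ'ᵢ ≫ G = σᵢ` in `Over S`), the level structures are related along `𝟙 S`
(`LevelStructure.IsBaseChangeVia`). [cite: MumfordFogartyKirwan1994, Ch. 7 §2 Definition 7.3 (p. 130)] -/
theorem levelStructure_isBaseChangeVia_id_of_isMonHom {g n : ℕ} {A' A : AbelianSchemeOver S}
    (φ' : A'.LevelStructure g n) (φ : A.LevelStructure g n) (G : A'.X ⟶ A.X) [IsIso G] [IsMonHom G]
    (hσ : ∀ i, φ'.σ i ≫ G = φ.σ i) : φ'.IsBaseChangeVia φ (𝟙 S) G.left := by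
  refine ⟨isBaseChangeVia_id_of_isMonHom A' A G, fun i => ?_⟩
  rw [Category.id_comp, ← Over.comp_left, hσ]


/-! ### (A) The identity-fibre bridge: `(A.fibre (𝟙 S)).toAbelianVariety ≅ A.toAffine.toAbelianVariety` AS GROUP SCHEMES
(S = `Spec K`): Mathlib's `Over.pullbackId` is monoidal for the cartesian structures, hence lifts to group objects
(`Functor.mapGrpNatIso`, `Functor.mapGrpIdIso`) — the template of ★ `AbelianScheme.fibreToGrpBaseChangeIso`. -/

section FibreId

variable {K : Type} [Field K]

/-- `A ×_S S → A` (pull-back along `𝟙 S`) is an isomorphism. [cite: GortzWedhorn2020, Section (4.7) (p. 135)] -/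
theorem isIso_pullback_fst_id {S : Scheme} (Y : Over S) : IsIso (pullback.fst Y.hom (𝟙 S)) := by
  refine ⟨⟨pullback.lift (𝟙 _) Y.hom (by rw [Category.id_comp, Category.comp_id]), ?_, pullback.lift_fst _ _ _⟩⟩
  apply pullback.hom_ext
  · rw [Category.assoc, pullback.lift_fst, Category.comp_id, Category.id_comp]
  · rw [Category.assoc, pullback.lift_snd, Category.id_comp, pullback.condition, Category.comp_id]

/-- `Over.pullback (𝟙 S) ≅ 𝟭` with EXPLICIT components `pullback.fst _ (𝟙 S)`. [folklore] -/
noncomputable def overPullbackIdIso (S : Scheme) : (Over.pullback (𝟙 S) : Over S ⥤ Over S) ≅ 𝟭 (Over S) :=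
  NatIso.ofComponents
    (fun Y => Over.isoMk (@asIso _ _ _ _ (pullback.fst Y.hom (𝟙 S)) (isIso_pullback_fst_id Y))
      (by
        change pullback.fst Y.hom (𝟙 S) ≫ Y.hom = pullback.snd Y.hom (𝟙 S)
        rw [pullback.condition, Category.comp_id]))
    (fun {Y Z} f => by
      ext
      change ((Over.pullback (𝟙 S)).map f).left ≫ pullback.fst Z.hom (𝟙 S) = pullback.fst Y.hom (𝟙 S) ≫ f.left
      exact pullback.lift_fst _ _ _)

/-- Component formula. [cite: GortzWedhorn2020, Section (4.7) (p. 135)] -/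
@[simp] theorem overPullbackIdIso_hom_app_left (S : Scheme) (Y : Over S) :
    ((overPullbackIdIso S).hom.app Y).left = pullback.fst Y.hom (𝟙 S) := by
  simp [overPullbackIdIso]

/-- The fibre at the identity point, as a GROUP scheme over `K`, is the abelian scheme itself
(`(Over.pullback (𝟙 _)).mapGrp ≅ 𝟭` applied to `A.toGrp`; the cartesian-monoidal natural iso lifts to group objects).
[cite: GortzWedhorn2020, Section (4.7) (p. 135)] -/
noncomputable def fibreIdToGrpIso (A : AbelianSchemeOver (Spec (.of K))) :
    (A.fibre (𝟙 (Spec (.of K)))).toAbelianVariety.toGrp ≅ A.toAffine.toAbelianVariety.toGrp :=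
  (Functor.mapGrpNatIso (overPullbackIdIso (Spec (.of K))) ≪≫ Functor.mapGrpIdIso).app A.toAffine.toAbelianVariety.toGrp

/-- Its underlying morphism of schemes is the first projection `A ×_S S → A`. [cite: GortzWedhorn2020, Section (4.7) (p. 135)] -/
theorem fibreIdToGrpIso_hom_left (A : AbelianSchemeOver (Spec (.of K))) :
    (fibreIdToGrpIso A).hom.hom.hom.left = pullback.fst A.X.hom (𝟙 (Spec (.of K))) := by
  simp [fibreIdToGrpIso]
  erw [Category.comp_id]

/-- The same as an isomorphism of abelian varieties over `K`. [cite: GortzWedhorn2020, Section (4.7) (p. 135)] -/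
noncomputable def fibreIdIso (A : AbelianSchemeOver (Spec (.of K))) :
    (A.fibre (𝟙 (Spec (.of K)))).toAbelianVariety ≅ A.toAffine.toAbelianVariety :=
  InducedCategory.isoMk (fibreIdToGrpIso A)

/-- Its underlying morphism of group schemes is the lifted natural isomorphism (by definition). [cite: GortzWedhorn2020, Section (4.7) (p. 135)] -/
theorem fibreIdIso_hom_hom (A : AbelianSchemeOver (Spec (.of K))) :
    (fibreIdIso A).hom.hom = (fibreIdToGrpIso A).hom := rfl

/-- **Bridge for (c-i)**: an isomorphism of the IDENTITY FIBRES (as abelian varieties over `K`, e.g. from the T1′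
marking theorems ★ `SiegelAdelicMarking.exists_iso_forall_map_r_eq_self` / ★ R60-57b) yields an isomorphism of the
underlying `Spec K`-GROUP schemes (in `Grp (Over (Spec K))`). [cite: MumfordFogartyKirwan1994, Ch. 7 §2 Definition 7.3 (p. 130)] -/
noncomputable def grpIsoOfFibreIso (A' A : AbelianSchemeOver (Spec (.of K)))
    (h : (A'.fibre (𝟙 (Spec (.of K)))).toAbelianVariety ≅ (A.fibre (𝟙 (Spec (.of K)))).toAbelianVariety) :
    A'.toAffine.toAbelianVariety.toGrp ≅ A.toAffine.toAbelianVariety.toGrp :=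
  (fibreIdToGrpIso A').symm ≪≫ ((inducedFunctor Motives.AbelianVariety.toGrp).mapIso h) ≪≫ fibreIdToGrpIso A

/-- … hence the abelian schemes are related by `IsBaseChangeVia` along `𝟙 (Spec K)` through the underlying morphism of
that group-scheme isomorphism ((c-i) applied; `IsMonHom` is the `Grp`-morphism's own field). [cite: MumfordFogartyKirwan1994, Ch. 7 §2 Definition 7.3 (p. 130)] -/
theorem isBaseChangeVia_id_of_fibreIso (A' A : AbelianSchemeOver (Spec (.of K)))
    (h : (A'.fibre (𝟙 (Spec (.of K)))).toAbelianVariety ≅ (A.fibre (𝟙 (Spec (.of K)))).toAbelianVariety) :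
    A'.IsBaseChangeVia A (𝟙 (Spec (.of K))) (grpIsoOfFibreIso A' A h).hom.hom.hom.left := by
  have hI : @IsIso (Over (Spec (.of K))) _ A'.X A.X (grpIsoOfFibreIso A' A h).hom.hom.hom := by
    change IsIso ((Grp.forget (Over (Spec (.of K)))).map (grpIsoOfFibreIso A' A h).hom)
    infer_instance
  have hM : @IsMonHom (Over (Spec (.of K))) _ _ A'.X A.X A'.grpObj.toMonObj A.grpObj.toMonObj
      (grpIsoOfFibreIso A' A h).hom.hom.hom := by
    change IsMonHom (grpIsoOfFibreIso A' A h).hom.hom.hom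
    infer_instance
  exact @isBaseChangeVia_id_of_isMonHom _ A' A (grpIsoOfFibreIso A' A h).hom.hom.hom hI hM

/-- Projection of the bridge iso to underlying schemes: `inv' ≫ h ≫ fst`. [cite: GortzWedhorn2020, Section (4.7) (p. 135)] -/
theorem grpIsoOfFibreIso_hom_left (A' A : AbelianSchemeOver (Spec (.of K)))
    (h : (A'.fibre (𝟙 (Spec (.of K)))).toAbelianVariety ≅ (A.fibre (𝟙 (Spec (.of K)))).toAbelianVariety) :
    (grpIsoOfFibreIso A' A h).hom.hom.hom.left =
      (fibreIdToGrpIso A').inv.hom.hom.left ≫ h.hom.hom.hom.hom.left ≫ pullback.fst A.X.hom (𝟙 (Spec (.of K))) := by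
  rw [← fibreIdToGrpIso_hom_left]
  rfl

/-- The inverse bridge composed with the projection is the identity on underlying schemes. [cite: GortzWedhorn2020, Section (4.7) (p. 135)] -/
theorem fibreIdToGrpIso_inv_left_fst (A : AbelianSchemeOver (Spec (.of K))) :
    (fibreIdToGrpIso A).inv.hom.hom.left ≫ pullback.fst A.X.hom (𝟙 (Spec (.of K))) = 𝟙 _ := by
  rw [← fibreIdToGrpIso_hom_left]
  change ((fibreIdToGrpIso A).inv ≫ (fibreIdToGrpIso A).hom).hom.hom.left = _
  rw [Iso.inv_hom_id]
  rfl

/-- A section, pushed into the identity fibre by the inverse bridge, is its restriction `σ(𝟙)`. [cite: GortzWedhorn2020, Section (4.7) (p. 135)] -/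
theorem section_left_comp_inv_left (A : AbelianSchemeOver (Spec (.of K))) (τ : A.Sections) :
    τ.left ≫ (fibreIdToGrpIso A).inv.hom.hom.left = (A.restrictPt (𝟙 (Spec (.of K))) τ).left := by
  haveI := isIso_pullback_fst_id A.X
  have e1 : (τ.left ≫ (fibreIdToGrpIso A).inv.hom.hom.left) ≫ pullback.fst A.X.hom (𝟙 (Spec (.of K))) = τ.left := by
    erw [Category.assoc, fibreIdToGrpIso_inv_left_fst, Category.comp_id]
  have e2 : (A.restrictPt (𝟙 (Spec (.of K))) τ).left ≫ pullback.fst A.X.hom (𝟙 (Spec (.of K))) = τ.left := by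
    rw [AbelianSchemeOver.restrictPt_left_fst, Category.id_comp]
  exact (cancel_mono (pullback.fst A.X.hom (𝟙 (Spec (.of K))))).1 (e1.trans e2.symm)

/-- **(c-iv′) SECTION BRIDGE**: if the fibre isomorphism `h` carries the point `σ'(𝟙)` to `σ(𝟙)` (this is what the marked
data give: `Λ'.lift N eᵢ = σ'ᵢ(𝟙)`, `Λ.lift N eᵢ = σᵢ(𝟙)` by D3 `lift_level`, and `h (m'.r v) = m.r w` along `AdelicCongr`),
then the induced group-scheme isomorphism carries the SECTION `σ'` to `σ` — the hypothesis `hσ` of (c-iv).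
[cite: MumfordFogartyKirwan1994, Ch. 7 §2 Definition 7.3 (p. 130)] -/
theorem section_comp_grpIso_eq {A' A : AbelianSchemeOver (Spec (.of K))}
    (h : (A'.fibre (𝟙 (Spec (.of K)))).toAbelianVariety ≅ (A.fibre (𝟙 (Spec (.of K)))).toAbelianVariety)
    (σ' : A'.Sections) (σ : A.Sections)
    (hσ : AlgPoints.map h.hom.hom.hom.hom (A'.restrictPt (𝟙 (Spec (.of K))) σ') = A.restrictPt (𝟙 (Spec (.of K))) σ) :
    σ' ≫ (grpIsoOfFibreIso A' A h).hom.hom.hom = σ := by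
  have e3 : (A'.restrictPt (𝟙 (Spec (.of K))) σ').left ≫ h.hom.hom.hom.hom.left =
      (A.restrictPt (𝟙 (Spec (.of K))) σ).left := by
    rw [← Over.comp_left]
    exact congrArg Over.Hom.left hσ
  ext
  erw [Over.comp_left, grpIsoOfFibreIso_hom_left, ← Category.assoc, ← Category.assoc, section_left_comp_inv_left, e3,
    AbelianSchemeOver.restrictPt_left_fst, Category.id_comp]

/-- **(c-i)+(c-iv)+(c-iv′) COMBINED — the LEVEL/X clause of the triple transport along `𝟙 (Spec K)` from fibre data**:
an isomorphism `h` of the identity fibres carrying each `σ'ᵢ(𝟙)` to `σᵢ(𝟙)` yields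
`φ'.IsBaseChangeVia φ (𝟙 _) H` for the induced group-scheme isomorphism `H`. [cite: MumfordFogartyKirwan1994, Ch. 7 §2 Definition 7.3 (p. 130)] -/
theorem levelStructure_isBaseChangeVia_id_of_fibreIso {g n : ℕ} {A' A : AbelianSchemeOver (Spec (.of K))}
    (φ' : A'.LevelStructure g n) (φ : A.LevelStructure g n)
    (h : (A'.fibre (𝟙 (Spec (.of K)))).toAbelianVariety ≅ (A.fibre (𝟙 (Spec (.of K)))).toAbelianVariety)
    (hσ : ∀ i, AlgPoints.map h.hom.hom.hom.hom (A'.restrictPt (𝟙 (Spec (.of K))) (φ'.σ i)) =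
      A.restrictPt (𝟙 (Spec (.of K))) (φ.σ i)) :
    φ'.IsBaseChangeVia φ (𝟙 (Spec (.of K))) (grpIsoOfFibreIso A' A h).hom.hom.hom.left := by
  have hI : @IsIso (Over (Spec (.of K))) _ A'.X A.X (grpIsoOfFibreIso A' A h).hom.hom.hom := by
    change IsIso ((Grp.forget (Over (Spec (.of K)))).map (grpIsoOfFibreIso A' A h).hom)
    infer_instance
  have hM : @IsMonHom (Over (Spec (.of K))) _ _ A'.X A.X A'.grpObj.toMonObj A.grpObj.toMonObj
      (grpIsoOfFibreIso A' A h).hom.hom.hom := by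
    change IsMonHom (grpIsoOfFibreIso A' A h).hom.hom.hom
    infer_instance
  exact @levelStructure_isBaseChangeVia_id_of_isMonHom _ _ _ A' A φ' φ (grpIsoOfFibreIso A' A h).hom.hom.hom hI hM
    (fun i => section_comp_grpIso_eq h _ _ (hσ i))

end FibreId


end AbelianSchemeOver

end Literature.AlgebraicGeometry.AbelianSchemes

end
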